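import Summits.ValiantsHypothesis.ValiantsHypothesis.Theorems.KPlusLogSqLawTropicalBAffinePlaneDefs

/-!
# Route «KPlusLogSqLaw», crux `TropicalB` (stmt-ValiantsHypothesis-19771) — lines of the affine plane `(ZMod p)²`:
# the two-point double count and the VARIANCE IDENTITY of line sums (tool file for the affine-skeleton law)

HONEST FRAMING.  Helper toward the registered stubs `stub_tropThin` / `stub_tropFat` of `Cruxes/TropicalB/Lines/birth.lean`
(crux `Summit.ValiantsHypothesis.ValiantsHypothesis.Theses.KPlusLogSqLaw.TropicalB`, item stmt-ValiantsHypothesis-19771, route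
KPlusLogSqLaw; cell `pub-symmetroid`, seat val-sym-trop-p4 g9, 2026-08-27; `--supports … --as helper`).  Pure finite combinatorics
of the affine plane over `ZMod p` (`p` prime) plus an integer packing lemma; no design vocabulary.  Used by the companion file
`…TropicalBAffineSkeleton` (a NO-GO row of the register census: static designs whose dominant permutations are affine maps of
`ZMod p` have SUB-QUADRATICALLY many chain terms at `K = 3, 4`).  Nothing here bears on `TropicalB` in its window, `WeakLifting`,
DoorA26 / DoorA34, `MatrixDescartes` (stmt-ValiantsHypothesis-18050) or VP ≠ VNP.

CONTENTS.  Cells are `ZMod p × ZMod p` (row, column); the `p² + p` lines `AffinePlane.line p ℓ`, `ℓ : (ZMod p × ZMod p) ⊕ ZMod p`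
(graph lines `inl (γ, δ) = {(γ·b + δ, b)}` and columns `inr c`) are defined in `…TropicalBAffinePlaneDefs`.
* `card_linesThrough` — exactly `p + 1` lines pass through a cell; `card_linesThrough_pair` — exactly ONE line passes through two
  distinct cells (two points determine a line).
* `sum_lineCount` — `Σ_ℓ |S ∩ ℓ| = (p+1)·|S|`; `sum_lineCount_sq` — `Σ_ℓ |S ∩ ℓ|² = |S|·(p + |S|)` (double count of pairs);
* `lineCount_variance` — the VARIANCE IDENTITY `Σ_ℓ (p·|S ∩ ℓ| − |S|)² = p·|S|·(p² − |S|)` (all lines, any cell set `S`):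
  a set of cells cannot have widely spread line sums in many directions at once.
* `packing` — integer packing: for vectors `h i : Fin k → ℤ` injective on a finite family `A` and any centre `s`, scale `P > 0`
  and radius `t`, `t²·P²·(|A| − (2t+1)^k) ≤ Σ_{i ∈ A} Σ_l (P·h i l − s l)²` (at most `(2t+1)^k` of the vectors have every
  coordinate within `t·P` of the centre, the others contribute `≥ t²P²` each);
  `sq_le_of_law_two` — arithmetic: `(∀ t, t²(N − (2t+1)²) ≤ B) ⇒ N² ≤ 128·B + 4096` (the `K = 3` reading of the laws downstream).
[folklore: two points of an affine plane lie on one line; second-moment / discrete Radon-transform energy identity]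
-/

set_option linter.dupNamespace false
set_option autoImplicit false

namespace Summit.ValiantsHypothesis.ValiantsHypothesis.Theorems.KPlusLogSqLaw

namespace AffinePlane

open Finset

section Lines

variable (p : ℕ) [Fact p.Prime]

/-- the number of cells: `p`. [folklore] -/
theorem card_zmod : Fintype.card (ZMod p) = p := ZMod.card p

/-- the lines through a cell `x` are the `p` graph lines `inl (γ, x.1 − γ x.2)` and the column `inr x.2`. [folklore] -/
theorem linesThrough_eq (x : ZMod p × ZMod p) :
    (univ.filter fun ℓ => x ∈ line p ℓ) =
      insert (Sum.inr x.2) (univ.image fun γ : ZMod p => (Sum.inl (γ, x.1 - γ * x.2) : (ZMod p × ZMod p) ⊕ ZMod p)) := by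
  ext ℓ
  simp only [mem_filter, mem_univ, true_and, mem_insert, mem_image]
  rcases ℓ with ⟨γ, δ⟩ | c
  · rw [mem_line_inl]
    constructor
    · intro h
      right
      exact ⟨γ, by rw [h]; congr 1; ring⟩
    · rintro (h | ⟨γ', h⟩)
      · cases h
      · cases h
        ring
  · rw [mem_line_inr]
    constructor
    · intro h
      left
      rw [h]
    · rintro (h | ⟨γ', h⟩)
      · cases h; rfl
      · cases h

/-- **exactly `p + 1` lines through every cell.** [folklore] -/
theorem card_linesThrough (x : ZMod p × ZMod p) : (univ.filter fun ℓ => x ∈ line p ℓ).card = p + 1 := by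
  rw [linesThrough_eq, card_insert_of_notMem, card_image_of_injective, card_univ, card_zmod]
  · intro γ γ' h
    simp only [Sum.inl.injEq, Prod.mk.injEq] at h
    exact h.1
  · simp

/-- **two distinct cells lie on exactly one line.** [folklore] -/
theorem card_linesThrough_pair {x y : ZMod p × ZMod p} (hxy : x ≠ y) :
    (univ.filter fun ℓ => x ∈ line p ℓ ∧ y ∈ line p ℓ).card = 1 := by
  rw [card_eq_one]
  by_cases hc : x.2 = y.2
  · -- same column: the column line, and no graph line
    refine ⟨Sum.inr x.2, ?_⟩
    ext ℓ
    simp only [mem_filter, mem_univ, true_and, mem_singleton]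
    rcases ℓ with ⟨γ, δ⟩ | c
    · rw [mem_line_inl, mem_line_inl]
      constructor
      · rintro ⟨h1, h2⟩
        exfalso
        apply hxy
        exact Prod.ext (by rw [h1, h2, hc]) hc
      · intro h; cases h
    · rw [mem_line_inr, mem_line_inr]
      constructor
      · rintro ⟨h1, -⟩; rw [h1]
      · intro h; cases h; exact ⟨rfl, hc.symm⟩
  · -- different columns: the unique graph line
    have hne : x.2 - y.2 ≠ 0 := sub_ne_zero.mpr hc
    set γ₀ : ZMod p := (x.1 - y.1) * (x.2 - y.2)⁻¹ with hγ₀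
    refine ⟨Sum.inl (γ₀, x.1 - γ₀ * x.2), ?_⟩
    ext ℓ
    simp only [mem_filter, mem_univ, true_and, mem_singleton]
    rcases ℓ with ⟨γ, δ⟩ | c
    · rw [mem_line_inl, mem_line_inl]
      constructor
      · rintro ⟨h1, h2⟩
        have hγ : γ = γ₀ := by
          have e : x.1 - y.1 = γ * (x.2 - y.2) := by rw [h1, h2]; ring
          rw [hγ₀, e, mul_assoc, mul_inv_cancel₀ hne, mul_one]
        subst hγ
        congr 1
        congr 1
        rw [h1]; ring
      · intro h
        cases h
        refine ⟨by ring, ?_⟩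
        have : γ₀ * (x.2 - y.2) = x.1 - y.1 := by
          rw [hγ₀, mul_assoc, inv_mul_cancel₀ hne, mul_one]
        linear_combination this
    · rw [mem_line_inr, mem_line_inr]
      constructor
      · rintro ⟨h1, h2⟩
        exact absurd (h1.trans h2.symm) hc
      · intro h; cases h

/-- `|S ∩ ℓ|` as a sum of indicators. [folklore] -/
theorem card_filter_mem_line (S : Finset (ZMod p × ZMod p)) (ℓ : (ZMod p × ZMod p) ⊕ ZMod p) :
    ((S.filter fun x => x ∈ line p ℓ).card : ℤ) = ∑ x ∈ S, if x ∈ line p ℓ then (1 : ℤ) else 0 := by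
  rw [Finset.sum_ite, Finset.sum_const_zero, add_zero, Finset.sum_const, nsmul_eq_mul, mul_one]

/-- **first moment**: `Σ_ℓ |S ∩ ℓ| = (p+1)·|S|`. [folklore] -/
theorem sum_lineCount (S : Finset (ZMod p × ZMod p)) :
    ∑ ℓ, ((S.filter fun x => x ∈ line p ℓ).card : ℤ) = (p + 1) * S.card := by
  simp_rw [card_filter_mem_line]
  rw [Finset.sum_comm]
  have : ∀ x ∈ S, (∑ ℓ : (ZMod p × ZMod p) ⊕ ZMod p, if x ∈ line p ℓ then (1 : ℤ) else 0) = (p + 1 : ℤ) := by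
    intro x _
    rw [← Finset.sum_filter, Finset.sum_const, card_linesThrough]
    simp
  rw [Finset.sum_congr rfl this, Finset.sum_const, nsmul_eq_mul]
  ring

/-- **second moment** (double count of ordered pairs of cells): `Σ_ℓ |S ∩ ℓ|² = |S|·(p + |S|)`. [folklore] -/
theorem sum_lineCount_sq (S : Finset (ZMod p × ZMod p)) :
    ∑ ℓ, ((S.filter fun x => x ∈ line p ℓ).card : ℤ) ^ 2 = S.card * (p + S.card) := by
  have hsq : ∀ ℓ : (ZMod p × ZMod p) ⊕ ZMod p, ((S.filter fun x => x ∈ line p ℓ).card : ℤ) ^ 2 =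
      ∑ x ∈ S, ∑ y ∈ S, if x ∈ line p ℓ ∧ y ∈ line p ℓ then (1 : ℤ) else 0 := by
    intro ℓ
    rw [sq, card_filter_mem_line, Finset.sum_mul]
    refine Finset.sum_congr rfl fun x _ => ?_
    rw [Finset.mul_sum]
    refine Finset.sum_congr rfl fun y _ => ?_
    by_cases hx : x ∈ line p ℓ <;> by_cases hy : y ∈ line p ℓ <;> simp [hx, hy]
  simp_rw [hsq]
  rw [Finset.sum_comm]
  have inner : ∀ x ∈ S, (∑ ℓ : (ZMod p × ZMod p) ⊕ ZMod p, ∑ y ∈ S,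
      if x ∈ line p ℓ ∧ y ∈ line p ℓ then (1 : ℤ) else 0) = (p + 1 : ℤ) + (S.card - 1) := by
    intro x hx
    rw [Finset.sum_comm]
    have hy : ∀ y ∈ S, (∑ ℓ : (ZMod p × ZMod p) ⊕ ZMod p, if x ∈ line p ℓ ∧ y ∈ line p ℓ then (1 : ℤ) else 0) =
        if y = x then (p + 1 : ℤ) else 1 := by
      intro y _
      rw [← Finset.sum_filter, Finset.sum_const, nsmul_eq_mul, mul_one]
      split_ifs with hyx
      · subst hyx
        have : (univ.filter fun ℓ => y ∈ line p ℓ ∧ y ∈ line p ℓ) = univ.filter fun ℓ => y ∈ line p ℓ := by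
          ext ℓ; simp
        rw [this, card_linesThrough]; push_cast; ring
      · rw [card_linesThrough_pair p (Ne.symm hyx)]; simp
    rw [Finset.sum_congr rfl hy, Finset.sum_ite, Finset.sum_const, Finset.sum_const, nsmul_eq_mul,
      nsmul_eq_mul, mul_one]
    have h1 : (S.filter fun y => y = x).card = 1 := by
      rw [card_eq_one]
      refine ⟨x, ?_⟩
      ext y
      rw [Finset.mem_filter, Finset.mem_singleton]
      constructor
      · exact fun hy => hy.2
      · intro hy; rw [hy]; exact ⟨hx, rfl⟩
    have h2 : ((S.filter fun y => ¬ y = x).card : ℤ) = S.card - 1 := by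
      have := Finset.card_filter_add_card_filter_not (s := S) (fun y => y = x)
      rw [h1] at this
      omega
    rw [h1, h2]; push_cast; ring
  rw [Finset.sum_congr rfl inner, Finset.sum_const, nsmul_eq_mul]
  ring

/-- the number of lines: `p² + p`. [folklore] -/
theorem card_lineIndex : Fintype.card ((ZMod p × ZMod p) ⊕ ZMod p) = p ^ 2 + p := by
  rw [Fintype.card_sum, Fintype.card_prod, card_zmod]; ring

/-- **VARIANCE IDENTITY** of line sums: `Σ_ℓ (p·|S ∩ ℓ| − |S|)² = p·|S|·(p² − |S|)` over all `p² + p` lines — the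
second-moment budget that forbids a cell set from having widely spread line sums in many directions at once. [folklore] -/
theorem lineCount_variance (S : Finset (ZMod p × ZMod p)) :
    ∑ ℓ, ((p : ℤ) * (S.filter fun x => x ∈ line p ℓ).card - S.card) ^ 2 = p * S.card * (p ^ 2 - S.card) := by
  have expand : ∀ ℓ : (ZMod p × ZMod p) ⊕ ZMod p,
      ((p : ℤ) * (S.filter fun x => x ∈ line p ℓ).card - S.card) ^ 2 =
        (p : ℤ) ^ 2 * ((S.filter fun x => x ∈ line p ℓ).card : ℤ) ^ 2
          - 2 * p * S.card * ((S.filter fun x => x ∈ line p ℓ).card : ℤ) + (S.card : ℤ) ^ 2 := by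
    intro ℓ; ring
  simp_rw [expand]
  rw [Finset.sum_add_distrib, Finset.sum_sub_distrib, ← Finset.mul_sum, ← Finset.mul_sum, sum_lineCount_sq,
    sum_lineCount, Finset.sum_const, nsmul_eq_mul, Finset.card_univ, card_lineIndex]
  push_cast
  ring

/-- the variance budget in the crude form used downstream: `Σ_ℓ (p·|S ∩ ℓ| − |S|)² ≤ p³·|S|`. [folklore] -/
theorem lineCount_variance_le (S : Finset (ZMod p × ZMod p)) :
    ∑ ℓ, ((p : ℤ) * (S.filter fun x => x ∈ line p ℓ).card - S.card) ^ 2 ≤ (p : ℤ) ^ 3 * S.card := by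
  rw [lineCount_variance]
  have h0 : (0 : ℤ) ≤ S.card := by positivity
  have hp : (0 : ℤ) ≤ p := by positivity
  nlinarith [mul_nonneg (mul_nonneg hp h0) h0]

end Lines

/-! ## Integer packing -/

section Packing

/-- integers `w` with `|P·w − s| ≤ t·P` lie in an interval of `2t + 1` integers. [folklore] -/
theorem mem_Icc_of_abs_le {P : ℤ} (hP : 0 < P) (s : ℤ) (t : ℕ) {w : ℤ} (hw : |P * w - s| ≤ t * P) :
    w ∈ Finset.Icc ((s + t * P) / P - 2 * t) ((s + t * P) / P) := by
  rw [abs_le] at hw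
  obtain ⟨h1, h2⟩ := hw
  rw [Finset.mem_Icc]
  constructor
  · -- lower bound: `P·w ≥ s − tP = (s + tP) − 2tP ≥ P·q − 2tP` with `q = (s+tP)/P`
    have hq : P * ((s + t * P) / P) ≤ s + t * P := Int.mul_ediv_self_le (ne_of_gt hP)
    have : P * ((s + t * P) / P - 2 * t) ≤ P * w := by nlinarith
    exact le_of_mul_le_mul_left this hP
  · -- upper bound: `P·w ≤ s + tP`
    rw [Int.le_ediv_iff_mul_le hP]
    linarith

/-- **PACKING LEMMA.**  Vectors `h i : Fin k → ℤ` injective on `A`, any centre `s`, scale `P > 0`, radius `t`: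
`t²·P²·(|A| − (2t+1)^k) ≤ Σ_{i ∈ A} Σ_l (P·h i l − s l)²`. [folklore] -/
theorem packing {ι : Type*} [DecidableEq ι] (A : Finset ι) (k : ℕ) (h : ι → Fin k → ℤ) (hinj : Set.InjOn h A)
    (s : Fin k → ℤ) {P : ℤ} (hP : 0 < P) (t : ℕ) :
    (t : ℤ) ^ 2 * P ^ 2 * ((A.card : ℤ) - (2 * t + 1) ^ k) ≤ ∑ i ∈ A, ∑ l, (P * h i l - s l) ^ 2 := by
  classical
  -- near and far vectors
  set Ain := A.filter fun i => ∀ l, |P * h i l - s l| ≤ t * P with hAin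
  set Aout := A.filter fun i => ¬ ∀ l, |P * h i l - s l| ≤ t * P with hAout
  -- the near ones inject into a box with `(2t+1)^k` lattice points
  have hbox : Ain.card ≤ (2 * t + 1) ^ k := by
    set box : Finset (Fin k → ℤ) :=
      Fintype.piFinset fun l => Finset.Icc ((s l + t * P) / P - 2 * t) ((s l + t * P) / P) with hboxdef
    have hmaps : ∀ i ∈ Ain, h i ∈ box := by
      intro i hi
      rw [hAin, Finset.mem_filter] at hi
      rw [hboxdef, Fintype.mem_piFinset]
      intro l
      exact mem_Icc_of_abs_le hP (s l) t (hi.2 l)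
    have hinj' : Set.InjOn h Ain := fun i hi j hj e =>
      hinj (Finset.mem_of_mem_filter i hi) (Finset.mem_of_mem_filter j hj) e
    calc Ain.card ≤ box.card := Finset.card_le_card_of_injOn h hmaps hinj'
      _ = ∏ l : Fin k, (Finset.Icc ((s l + t * P) / P - 2 * t) ((s l + t * P) / P)).card := by
          rw [hboxdef, Fintype.card_piFinset]
      _ = ∏ _l : Fin k, (2 * t + 1) := by
          refine Finset.prod_congr rfl fun l _ => ?_
          rw [Int.card_Icc]
          have : (s l + t * P) / P + 1 - ((s l + t * P) / P - 2 * t) = 2 * t + 1 := by ring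
          rw [this]; norm_cast
      _ = (2 * t + 1) ^ k := by rw [Finset.prod_const, Finset.card_univ, Fintype.card_fin]
  -- the far ones contribute at least `t²P²` each
  have hfar : ∀ i ∈ Aout, (t : ℤ) ^ 2 * P ^ 2 ≤ ∑ l, (P * h i l - s l) ^ 2 := by
    intro i hi
    rw [hAout, Finset.mem_filter] at hi
    obtain ⟨l, hl⟩ := not_forall.mp hi.2
    rw [not_le] at hl
    have hsq : (t : ℤ) ^ 2 * P ^ 2 ≤ (P * h i l - s l) ^ 2 := by
      have h1 : ((t : ℤ) * P) ^ 2 ≤ |P * h i l - s l| ^ 2 := by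
        apply pow_le_pow_left₀ (by positivity) hl.le
      rw [sq_abs] at h1
      linarith [h1]
    exact hsq.trans (Finset.single_le_sum (f := fun l => (P * h i l - s l) ^ 2)
      (fun l _ => sq_nonneg _) (Finset.mem_univ l))
  have hsplit : A.card = Ain.card + Aout.card := by
    rw [hAin, hAout]; exact (Finset.card_filter_add_card_filter_not _).symm
  have hsum : ∑ i ∈ Aout, ∑ l, (P * h i l - s l) ^ 2 ≤ ∑ i ∈ A, ∑ l, (P * h i l - s l) ^ 2 :=
    Finset.sum_le_sum_of_subset_of_nonneg (Finset.filter_subset _ _)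
      (fun i _ _ => Finset.sum_nonneg fun l _ => sq_nonneg _)
  have hout : (t : ℤ) ^ 2 * P ^ 2 * Aout.card ≤ ∑ i ∈ Aout, ∑ l, (P * h i l - s l) ^ 2 := by
    have := Finset.card_nsmul_le_sum Aout (fun i => ∑ l, (P * h i l - s l) ^ 2) _ hfar
    rw [nsmul_eq_mul] at this
    linarith
  have hcard : (A.card : ℤ) - (2 * t + 1) ^ k ≤ Aout.card := by
    have : (Ain.card : ℤ) ≤ (2 * t + 1) ^ k := by exact_mod_cast hbox
    push_cast [hsplit]
    linarith
  calc (t : ℤ) ^ 2 * P ^ 2 * ((A.card : ℤ) - (2 * t + 1) ^ k)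
      ≤ (t : ℤ) ^ 2 * P ^ 2 * Aout.card := by
        apply mul_le_mul_of_nonneg_left hcard; positivity
    _ ≤ _ := hout.trans hsum

/-- **quantitative corollary in dimension two**: a law `∀ t, t²·(N − (2t+1)²) ≤ B` forces `N² ≤ 128·B + 4096`
(take `t = ⌊√N⌋/4`). [folklore] -/
theorem sq_le_of_law_two (N : ℕ) (B : ℤ) (h : ∀ t : ℕ, (t : ℤ) ^ 2 * ((N : ℤ) - (2 * t + 1) ^ 2) ≤ B) :
    (N : ℤ) ^ 2 ≤ 128 * B + 4096 := by
  have hB : (0 : ℤ) ≤ B := by have := h 0; simpa using this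
  by_cases hN : N < 64
  · have : (N : ℤ) < 64 := by exact_mod_cast hN
    have hN0 : (0 : ℤ) ≤ N := by positivity
    nlinarith
  push Not at hN
  set s := Nat.sqrt N with hs
  have hs1 : s * s ≤ N := Nat.sqrt_le N
  have hs2 : N < (s + 1) * (s + 1) := Nat.lt_succ_sqrt N
  have hs8 : 8 ≤ s := by
    by_contra hlt
    push Not at hlt
    have : (s + 1) * (s + 1) ≤ 64 := by nlinarith
    omega
  set t := s / 4 with ht
  have ht1 : 4 * t ≤ s := Nat.mul_div_le s 4
  have ht2 : s < 4 * t + 4 := by omega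
  have key := h t
  have zs1 : (s : ℤ) * s ≤ N := by exact_mod_cast hs1
  have zs2 : (N : ℤ) < (s + 1) * (s + 1) := by exact_mod_cast hs2
  have zs8 : (8 : ℤ) ≤ s := by exact_mod_cast hs8
  have zt1 : 4 * (t : ℤ) ≤ s := by exact_mod_cast ht1
  have zt2 : (s : ℤ) < 4 * t + 4 := by exact_mod_cast ht2
  -- `2(2t+1)² ≤ N` and `N ≤ 52 t²`
  have hA : 2 * (2 * (t : ℤ) + 1) ^ 2 ≤ N := by nlinarith
  have hB2 : (N : ℤ) ≤ 52 * (t : ℤ) ^ 2 := by nlinarith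
  have ht0 : (0 : ℤ) ≤ (t : ℤ) ^ 2 := by positivity
  have hNN : (0 : ℤ) ≤ (N : ℤ) - (2 * t + 1) ^ 2 := by nlinarith
  have h1 : (N : ℤ) * N ≤ 52 * (t : ℤ) ^ 2 * (2 * ((N : ℤ) - (2 * t + 1) ^ 2)) := by
    have e1 : (N : ℤ) ≤ 2 * ((N : ℤ) - (2 * t + 1) ^ 2) := by linarith
    have hN0 : (0 : ℤ) ≤ N := by positivity
    calc (N : ℤ) * N ≤ (52 * (t : ℤ) ^ 2) * N := by nlinarith
      _ ≤ (52 * (t : ℤ) ^ 2) * (2 * ((N : ℤ) - (2 * t + 1) ^ 2)) := by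
          apply mul_le_mul_of_nonneg_left e1; positivity
  nlinarith

end Packing

/-! ## Families of lines with pairwise distinct class histograms -/

section Histograms

variable (p : ℕ) [Fact p.Prime]

/-- **DISTINCT-HISTOGRAM LAW FOR LINES.**  Let `S l` (`l < k`) be cell sets of `(ZMod p)²` and `A` a family of lines on which the
histogram `ℓ ↦ (|S l ∩ ℓ|)_l` is injective.  Then for every radius `t`,
`t²·(|A| − (2t+1)^k) ≤ p·Σ_l |S l|`.  (Packing at scale `p` around the centre `(|S l|)_l`, then the variance identity summed
over the classes; with `Σ_l |S l| ≤ p²` this is `t²(|A| − (2t+1)^k) ≤ p³`, i.e. `|A| = O_k(p^{3k/(k+2)})` — sub-quadratic for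
`k ≤ 2`.) [folklore: second-moment method] -/
theorem distinctHistograms_law {k : ℕ} (S : Fin k → Finset (ZMod p × ZMod p))
    (A : Finset ((ZMod p × ZMod p) ⊕ ZMod p))
    (hinj : Set.InjOn (fun ℓ => fun l : Fin k => (((S l).filter fun x => x ∈ line p ℓ).card : ℤ)) A) (t : ℕ) :
    (t : ℤ) ^ 2 * ((A.card : ℤ) - (2 * t + 1) ^ k) ≤ p * ∑ l, ((S l).card : ℤ) := by
  classical
  have hp : (0 : ℤ) < p := by exact_mod_cast (Fact.out : p.Prime).pos
  have hpack := packing A k (fun ℓ => fun l : Fin k => (((S l).filter fun x => x ∈ line p ℓ).card : ℤ)) hinj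
    (fun l => ((S l).card : ℤ)) hp t
  -- bound the right-hand side by the full variance sums
  have hle : ∑ ℓ ∈ A, ∑ l, ((p : ℤ) * (((S l).filter fun x => x ∈ line p ℓ).card : ℤ) - (S l).card) ^ 2
      ≤ ∑ l, (p : ℤ) ^ 3 * (S l).card := by
    calc ∑ ℓ ∈ A, ∑ l, ((p : ℤ) * (((S l).filter fun x => x ∈ line p ℓ).card : ℤ) - (S l).card) ^ 2
        ≤ ∑ ℓ, ∑ l, ((p : ℤ) * (((S l).filter fun x => x ∈ line p ℓ).card : ℤ) - (S l).card) ^ 2 :=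
          Finset.sum_le_sum_of_subset_of_nonneg (Finset.subset_univ _)
            (fun ℓ _ _ => Finset.sum_nonneg fun l _ => sq_nonneg _)
      _ = ∑ l, ∑ ℓ, ((p : ℤ) * (((S l).filter fun x => x ∈ line p ℓ).card : ℤ) - (S l).card) ^ 2 :=
          Finset.sum_comm
      _ ≤ ∑ l, (p : ℤ) ^ 3 * (S l).card := Finset.sum_le_sum fun l _ => lineCount_variance_le p (S l)
  have key : (t : ℤ) ^ 2 * (p : ℤ) ^ 2 * ((A.card : ℤ) - (2 * t + 1) ^ k) ≤ (p : ℤ) ^ 2 * (p * ∑ l, ((S l).card : ℤ)) := by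
    calc (t : ℤ) ^ 2 * (p : ℤ) ^ 2 * ((A.card : ℤ) - (2 * t + 1) ^ k)
        ≤ ∑ l, (p : ℤ) ^ 3 * (S l).card := hpack.trans hle
      _ = (p : ℤ) ^ 2 * (p * ∑ l, ((S l).card : ℤ)) := by rw [Finset.mul_sum, Finset.mul_sum]; ring_nf
  have hp2 : (0 : ℤ) < (p : ℤ) ^ 2 := by positivity
  have : (p : ℤ) ^ 2 * ((t : ℤ) ^ 2 * ((A.card : ℤ) - (2 * t + 1) ^ k)) ≤ (p : ℤ) ^ 2 * (p * ∑ l, ((S l).card : ℤ)) := by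
    linarith [key]
  exact le_of_mul_le_mul_left this hp2

end Histograms

end AffinePlane

end Summit.ValiantsHypothesis.ValiantsHypothesis.Theorems.KPlusLogSqLaw
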